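import Summits.NavierStokesRegularity.NavierStokesRegularity.Theses.HodographBetchov
import Literature.Analysis.FluidPDE.TaoLocalisation

/-!
# `SlowClassProduction` (stmt-NavierStokesRegularity-15831) — reduction to the route's uniform form

Route `HodographBetchov`: the support `SlowClassProductionUniform` (stmt-NavierStokesRegularity-15837,
the quantitative, kit-falsifiable form of crux 2: ONE constant `C(ν, T, A, l)` for all classical
Leray–Hopf solutions from rapidly decaying data with energy and enstrophy of the datum at most `A`)
implies the crux `SlowClassProduction` (per-solution constant): a rapidly decaying datum has finite
energy and finite enstrophy (`HasRapidSpatialDecay.lintegral_enorm_iteratedFDeriv_sq_lt_top`, Tao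
2013 §1), so it belongs to the data class of bound `A = ‖u 0‖²₂ + ‖∇u 0‖²₂ + 1`, and the uniform
constant at that `A` serves.  Recorded as the registered reduction stub
`slowClassProduction_of_uniform` of the crux item (an edge of the route's DAG, crux 2 ⇐ support
15837; both statements are open a-priori bounds, the uniform one being the stronger).
-/

noncomputable section

-- the summit and its single problem share the name `NavierStokesRegularity` (D-0017 nested layout)
set_option linter.dupNamespace false

namespace Summit.NavierStokesRegularity.NavierStokesRegularity.Theorems.SlowClassProduction

open Set MeasureTheory Literature.Analysis.FluidPDE
open scoped ENNReal

/-- **The uniform slow-class bound implies the slow-class bound** (route `HodographBetchov`,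
support `SlowClassProductionUniform` ⇒ crux `SlowClassProduction`): given a classical Leray–Hopf
solution from a rapidly decaying datum `u 0` and a level `l`, the datum has finite energy
`E = ∫ ‖u 0‖²` and finite enstrophy `F = ∫ ‖∇(u 0)‖²` (Schwartz ⇒ `H¹`, Tao 2013 §1 p. 3), so the
uniform constant `C(ν, T, A, l)` with `A = E + F + 1` bounds its slow-class production on every
`[0,t]`, `t < T`. [cite: Tao2011, §1 p. 3] -/
theorem slowClassProduction_of_uniform :
    Summit.NavierStokesRegularity.NavierStokesRegularity.Theses.HodographBetchov.SlowClassProductionUniform →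
      Summit.NavierStokesRegularity.NavierStokesRegularity.Theses.HodographBetchov.SlowClassProduction := by
  intro hU ν T hν hT u p hcl hLH hdec l hl
  -- energy and enstrophy of the datum are finite
  have hE : ∫⁻ x, ‖u 0 x‖ₑ ^ 2 < ⊤ := by
    have h := hdec.lintegral_enorm_iteratedFDeriv_sq_lt_top (μ := volume) 0
    simpa only [norm_iteratedFDeriv_zero, ← ofReal_norm] using h
  have hF : ∫⁻ x, ‖fderiv ℝ (u 0) x‖ₑ ^ 2 < ⊤ := by
    have h := hdec.lintegral_enorm_iteratedFDeriv_sq_lt_top (μ := volume) 1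
    simpa only [norm_iteratedFDeriv_one, ← ofReal_norm] using h
  set E : ℝ≥0∞ := ∫⁻ x, ‖u 0 x‖ₑ ^ 2 with hE_def
  set F : ℝ≥0∞ := ∫⁻ x, ‖fderiv ℝ (u 0) x‖ₑ ^ 2 with hF_def
  set A : ℝ := E.toReal + F.toReal + 1 with hA_def
  have hA : 0 < A := by rw [hA_def]; positivity
  have hEA : E ≤ ENNReal.ofReal A := by
    rw [← ENNReal.ofReal_toReal hE.ne]
    exact ENNReal.ofReal_le_ofReal (by rw [hA_def]; linarith [ENNReal.toReal_nonneg (a := F)])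
  have hFA : F ≤ ENNReal.ofReal A := by
    rw [← ENNReal.ofReal_toReal hF.ne]
    exact ENNReal.ofReal_le_ofReal (by rw [hA_def]; linarith [ENNReal.toReal_nonneg (a := E)])
  obtain ⟨C, hC⟩ := hU ν T A l hν hT hA hl
  exact ⟨C, hC u p hcl hLH hdec hEA hFA⟩

end Summit.NavierStokesRegularity.NavierStokesRegularity.Theorems.SlowClassProduction

end
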